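import Mathlib
import Summits.Schanuel.Statement
import Summits.Schanuel.Schanuel.Theses.RootDecomp1E
import Summits.Schanuel.Schanuel.Theorems.RootDecomp1EAnchorToolkit
import Summits.Schanuel.Schanuel.Theorems.RootDecomp1EDefectOneSplit
import Summits.Schanuel.Schanuel.Theorems.RootDecomp1EModuleGrids
import Summits.Schanuel.Schanuel.Theorems.RootDecomp1EModuleType
import Summits.Schanuel.Schanuel.Theorems.RootDecomp1EEngineType
import Literature.NumberTheory.Transcendental.PeriodsWave0
import Literature.NumberTheory.Transcendental.LindemannWeierstrassProofs

-- `Summit.Schanuel.Schanuel.…` is the mandated layout of this single-problem summit (CONVENTIONS §1).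
set_option linter.dupNamespace false

/-!
# RootDecomp1E, round 11 (lens 2 «LEVELS»), part 1: the Lindemann–Weierstrass LEVEL of a first failure

Supports `stmt-Schanuel-31410` (`RootDecomp1E.PlainDefectOne`, residual of record) and its parent `stmt-Schanuel-25020`
(`DefectOneSchanuel`).  PORT of §1–§4, §4c of the lens-2 gen-11 node `Levels.lean` (HOME
`decomp-schanuel-lens-2/g11/`), in LAYER FORM (parametrised predicates only, no closed `Prop` items, no `closes`).

* §1 `LWLevel k z` (there are `k` ℚ-free algebraic `bⱼ` with every `e^{bⱼ}` algebraic over `F_z = ℚ(z, e^z)`); the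
  LEVEL INEQUALITY `le_trdeg_of_lwLevel : LWLevel k z → k ≤ trdeg F_z` (Lindemann–Weierstrass, tree theorem
  `algebraicIndependent_exp_holds`, HYPOTHESIS-FREE); round 10's `LWRich = LWLevel 2`.
* §2 the LEVEL CUT of `S⁻`: `LWSaturatedDefectOneAt n` (level `≥ n − 1`) is DECIDED for every `n`
  (`lwSaturatedDefectOneAt_holds`); exactness `defectOne_iff_lwSplit` (instance of `defectOne_iff_typeSplit`);
  `defectOne_iff_lwDeficientAt : DefectOneSchanuel ↔ ∀ n, LWDeficientDefectOneAt n`; dictionary with 31409/31410 and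
  with round 10's `FirstFailureLayer`.
* §3 LEVEL TEETH: a first failure of length `n` has level `≤ n − 2` (`lwLevel_add_two_le_of_firstFailure`).
* §4 the ALGEBRAIC-HYPERPLANE FAMILY `(τ | b₁ … b_m)` (`τ` transcendental, `b` ℚ-free algebraic): ℚ-free, PLAIN,
  SUB-MINIMAL (via the SUB-LEVEL LEMMA `lwLevel_of_mem_span_cons`), saturated, and `S⁻` PROVED on it hypothesis-free at
  every length (`defectOne_at_cons`, `cons_mem_plainClass`); §4c members exist at EVERY length
  (`exists_decided_plain_member`, roots of unity).
-/

noncomputable section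

namespace Summit.Schanuel.Schanuel.Theorems.RootDecomp1ELevels

open Complex IntermediateField
open Summit.Schanuel.Schanuel.Theses.RootDecomp1E (DefectOneSchanuel EStableDefectOne PlainDefectOne)
open Summit.Schanuel.Schanuel.Theorems.RootDecomp1EAnchor (isAlgebraic_of_mem_adjoin
  trdeg_adjoin_le_of_isAlgebraic mem_adjoin_of_mem_span exp_isAlgebraic_of_mem_span isAlgebraic_transfer
  trdeg_adjoin_le_nat trdeg_le_of_mem_span exists_nat_eq_of_le_natCast span_range_le
  exists_basis_span_inf isAlgebraic_of_trdeg_sandwich isAlgebraic_of_le isAlgebraic_mul isAlgebraic_add)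
open Summit.Schanuel.Schanuel.Theorems.RootDecomp1EModuleGrids (subMinimal_three rat_mul_pi_eq_rat)
open Summit.Schanuel.Schanuel.Theorems.RootDecomp1EModuleType (SubMinimalDefect)
open Summit.Schanuel.Schanuel.Theorems.RootDecomp1EEngineType (LWRich PeriodRich EngineRich
  EngineRichDefectOneAt EngineDarkDefectOneAt FirstFailureLayer defectOne_iff_typeSplit defectOne_iff_layers
  trdeg_eq_nat le_trdeg_add_one_of_subMinimal two_le_trdeg_of_subMinimal trdeg_add_two_eq_of_firstFailure
  linearIndependent_comp_castLE two_le_trdeg_of_lwRich)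
open Literature.NumberTheory.Transcendental (nesterenko nesterenko' algebraicIndependent_exp_holds
  transcendental_pi_holds transcendental_exp_holds)

/-! ## §0 Helper -/

/-- `![k₀, k₁]` is injective for distinct indices. -/
theorem injective_pair {n : ℕ} {k₀ k₁ : Fin n} (h : k₀ ≠ k₁) : Function.Injective ![k₀, k₁] := by
  intro i j hij
  fin_cases i <;> fin_cases j <;> simp_all [eq_comm]

/-! ## §1 The LW-level of a tuple and the LEVEL INEQUALITY -/

/-- **LW-LEVEL ≥ k.**  `z` has Lindemann–Weierstrass level `≥ k` if there are `k` ℚ-linearly independent ALGEBRAIC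
numbers `b₁, …, b_k` whose exponentials `e^{b_j}` are algebraic over `F_z = ℚ(z, e^z)` — `k` independent algebraic
points of the exponential module of `F_z^{alg}`.  Round 10's `LWRich` is `LWLevel 2`. -/
def LWLevel {ι : Type*} (k : ℕ) (z : ι → ℂ) : Prop :=
  ∃ b : Fin k → ℂ, LinearIndependent ℚ b ∧ (∀ j, IsAlgebraic ℚ (b j)) ∧
    ∀ j, IsAlgebraic ↥(IntermediateField.adjoin ℚ (Set.range z ∪ Set.range (Complex.exp ∘ z))) (Complex.exp (b j))

/-- Dictionary with round 10: `LWRich = LWLevel 2` on the nose. -/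
theorem lwRich_iff_lwLevel_two {ι : Type*} (z : ι → ℂ) : LWRich z ↔ LWLevel 2 z := Iff.rfl

/-- Level `0` is free. -/
theorem lwLevel_zero {ι : Type*} (z : ι → ℂ) : LWLevel 0 z :=
  ⟨fun i => Fin.elim0 i, linearIndependent_empty_type, fun j => Fin.elim0 j, fun j => Fin.elim0 j⟩

/-- Levels are downward closed. -/
theorem lwLevel_mono {ι : Type*} {j k : ℕ} (hjk : j ≤ k) (z : ι → ℂ) (h : LWLevel k z) : LWLevel j z := by
  obtain ⟨b, hb, halg, hbF⟩ := h
  exact ⟨b ∘ Fin.castLE hjk, linearIndependent_comp_castLE hjk hb, fun i => halg _, fun i => hbF _⟩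

/-- The level is an invariant of the ℚ-span (indeed monotone in it). -/
theorem lwLevel_of_span_le {ι κ : Type*} {k : ℕ} {z : ι → ℂ} {w : κ → ℂ}
    (h : ∀ i, z i ∈ Submodule.span ℚ (Set.range w)) (hz : LWLevel k z) : LWLevel k w := by
  obtain ⟨b, hb, halg, hbF⟩ := hz
  exact ⟨b, hb, halg, fun j => isAlgebraic_transfer h (hbF j)⟩

/-- `k` algebraically independent elements of an intermediate field give it transcendence degree `≥ k`. -/
theorem le_trdeg_of_algebraicIndependent {L : IntermediateField ℚ ℂ} {k : ℕ} {v : Fin k → ℂ}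
    (hv : AlgebraicIndependent ℚ v) (hmem : ∀ i, v i ∈ L) : (k : Cardinal) ≤ Algebra.trdeg ℚ ↥L := by
  let y : Fin k → ↥L := fun i => ⟨v i, hmem i⟩
  have hy : AlgebraicIndependent ℚ y := AlgebraicIndependent.of_comp L.val hv
  simpa using hy.cardinalMk_le_trdeg

/-- **THE LEVEL INEQUALITY** `LWLevel k z ⟹ k ≤ trdeg F_z` — Lindemann–Weierstrass (tree theorem
`algebraicIndependent_exp_holds`, HYPOTHESIS-FREE) at `k` points, transported into `F_z` by algebraicity.
The only engine of the tree whose output is UNBOUNDED in the length. -/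
theorem le_trdeg_of_lwLevel {ι : Type*} {k : ℕ} (z : ι → ℂ) (h : LWLevel k z) :
    (k : Cardinal) ≤ Algebra.trdeg ℚ ↥(adjoin ℚ (Set.range z ∪ Set.range (cexp ∘ z))) := by
  obtain ⟨b, hb, halg, hbF⟩ := h
  have hai : AlgebraicIndependent ℚ fun j => cexp (b j) := algebraicIndependent_exp_holds b halg hb
  have h1 : (k : Cardinal) ≤ Algebra.trdeg ℚ ↥(adjoin ℚ (Set.range fun j => cexp (b j))) :=
    le_trdeg_of_algebraicIndependent hai (fun j => subset_adjoin ℚ _ ⟨j, rfl⟩)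
  exact h1.trans (trdeg_adjoin_le_of_isAlgebraic (by rintro _ ⟨j, rfl⟩; exact hbF j))

/-- At FULL level `n` (`n` = the length) Schanuel's conclusion ITSELF holds at `z`: the Lindemann–Weierstrass locus of `S`. -/
theorem schanuel_at_of_lwLevel {n : ℕ} (z : Fin n → ℂ) (h : LWLevel n z) :
    (n : Cardinal) ≤ Algebra.trdeg ℚ ↥(adjoin ℚ (Set.range z ∪ Set.range (cexp ∘ z))) :=
  le_trdeg_of_lwLevel z h

/-! ## §2 The LEVEL CUT of `S⁻`: saturated layers DECIDED at every length, exactness (layer form; no closed items) -/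

/-- LW-SATURATED layer `n`: `S⁻` at the sub-minimal ℚ-free `n`-tuples of LW-level `≥ n − 1`. -/
def LWSaturatedDefectOneAt (n : ℕ) : Prop :=
  ∀ (z : Fin n → ℂ), LinearIndependent ℚ z → LWLevel (n - 1) z → SubMinimalDefect n z →
    (n : Cardinal) ≤ Algebra.trdeg ℚ ↥(IntermediateField.adjoin ℚ (Set.range z ∪ Set.range (Complex.exp ∘ z))) + 1

/-- LW-DEFICIENT layer `n`: `S⁻` at the sub-minimal ℚ-free `n`-tuples of LW-level `≤ n − 2` (the generic side). -/
def LWDeficientDefectOneAt (n : ℕ) : Prop :=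
  ∀ (z : Fin n → ℂ), LinearIndependent ℚ z → ¬ LWLevel (n - 1) z → SubMinimalDefect n z →
    (n : Cardinal) ≤ Algebra.trdeg ℚ ↥(IntermediateField.adjoin ℚ (Set.range z ∪ Set.range (Complex.exp ∘ z))) + 1

/-- **THE SATURATED LAYERS ARE DECIDED — AT EVERY LENGTH, HYPOTHESIS-FREE** (output `trdeg F_z ≥ n − 1`; the
sub-minimality hypothesis is not even used). -/
theorem lwSaturatedDefectOneAt_holds (n : ℕ) : LWSaturatedDefectOneAt n := by
  intro z _ hL _
  have h := le_trdeg_of_lwLevel z hL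
  obtain ⟨t, ht, _⟩ := trdeg_eq_nat z
  rw [ht] at h ⊢
  have h' : n - 1 ≤ t := by exact_mod_cast h
  exact_mod_cast (show n ≤ t + 1 by omega)

/-- **EXACTNESS of the level cut**: `S⁻ ⟺ (saturated layers) ∧ (deficient layers)` (the type-split schema). -/
theorem defectOne_iff_lwSplit :
    DefectOneSchanuel ↔ (∀ n, LWSaturatedDefectOneAt n) ∧ (∀ n, LWDeficientDefectOneAt n) :=
  defectOne_iff_typeSplit (fun {n} z => LWLevel (n - 1) z)

/-- Hence `S⁻ ⟺` ITS LW-DEFICIENT LAYERS (both directions kernel-checked). -/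
theorem defectOne_iff_lwDeficientAt : DefectOneSchanuel ↔ ∀ n, LWDeficientDefectOneAt n :=
  ⟨fun hD n z hz _ _ => hD n z hz, fun h => defectOne_iff_lwSplit.mpr ⟨lwSaturatedDefectOneAt_holds, h⟩⟩

/-- Dictionary with the live items: the residual pair of record 31409/31410 implies the deficient layers … -/
theorem lwDeficientAt_of_eStable_plain (hE : EStableDefectOne) (hP : PlainDefectOne) (n : ℕ) :
    LWDeficientDefectOneAt n :=
  defectOne_iff_lwDeficientAt.mp
    (Summit.Schanuel.Schanuel.Theorems.RootDecomp1EDefectOneSplit.defectOneSchanuelGlue_holds hE hP) n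

/-- … and conversely (the level cut is a RE-CUT of the same `S⁻`, transverse to E-stable/plain). -/
theorem eStable_plain_of_lwDeficientAt (h : ∀ n, LWDeficientDefectOneAt n) : EStableDefectOne ∧ PlainDefectOne :=
  ⟨fun n z hz _ _ => defectOne_iff_lwDeficientAt.mpr h n z hz, fun n z hz _ _ => defectOne_iff_lwDeficientAt.mpr h n z hz⟩

/-- Dictionary with round 10's type-free layers: layerwise equivalence (the saturated half being proved). -/
theorem firstFailureLayer_iff_lwDeficientAt (n : ℕ) : FirstFailureLayer n ↔ LWDeficientDefectOneAt n := by
  refine ⟨fun h z hz _ hsub => h z hz hsub, fun h z hz hsub => ?_⟩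
  by_cases hL : LWLevel (n - 1) z
  · exact lwSaturatedDefectOneAt_holds n z hz hL hsub
  · exact h z hz hL hsub

/-! ## §3 TEETH for levels: a first failure of length `n` has LW-level `≤ n − 2 = trdeg F_z` -/

/-- At a first failure (sub-minimal, ℚ-free, `S⁻` false) the LW-level is `< n − 1` … -/
theorem not_lwLevel_of_firstFailure {n : ℕ} {z : Fin n → ℂ} (hz : LinearIndependent ℚ z)
    (hsub : SubMinimalDefect n z)
    (hfail : ¬ (n : Cardinal) ≤ Algebra.trdeg ℚ ↥(adjoin ℚ (Set.range z ∪ Set.range (cexp ∘ z))) + 1) :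
    ¬ LWLevel (n - 1) z :=
  fun hL => hfail (lwSaturatedDefectOneAt_holds n z hz hL hsub)

/-- … precisely: every level `k` it has satisfies `k + 2 ≤ n` (`trdeg F_z = n − 2` there, `trdeg_add_two_eq_of_firstFailure`). -/
theorem lwLevel_add_two_le_of_firstFailure {n k : ℕ} {z : Fin n → ℂ} (hz : LinearIndependent ℚ z)
    (hsub : SubMinimalDefect n z)
    (hfail : ¬ (n : Cardinal) ≤ Algebra.trdeg ℚ ↥(adjoin ℚ (Set.range z ∪ Set.range (cexp ∘ z))) + 1)
    (hL : LWLevel k z) : k + 2 ≤ n := by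
  have h := le_trdeg_of_lwLevel z hL
  have he := (trdeg_add_two_eq_of_firstFailure hz hsub hfail).1
  obtain ⟨t, ht, _⟩ := trdeg_eq_nat z
  rw [ht] at h he
  have h' : k ≤ t := by exact_mod_cast h
  have he' : t + 2 = n := by exact_mod_cast he
  omega

/-! ## §4 THE ALGEBRAIC-HYPERPLANE FAMILY `(τ | b₁, …, b_m)`: certified, decided members of the residual's class at
EVERY length -/

/-- ℚ-linear combinations of algebraic numbers are algebraic. -/
theorem isAlgebraic_of_mem_span_of_isAlgebraic {ι : Type*} {b : ι → ℂ} (halg : ∀ j, IsAlgebraic ℚ (b j)) {x : ℂ}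
    (hx : x ∈ Submodule.span ℚ (Set.range b)) : IsAlgebraic ℚ x := by
  have hle : Submodule.span ℚ (Set.range b) ≤ (algebraicClosure ℚ ℂ).toSubalgebra.toSubmodule := by
    rw [Submodule.span_le]
    rintro _ ⟨j, rfl⟩
    exact mem_algebraicClosure_iff.mpr (halg j)
  exact mem_algebraicClosure_iff.mp (hle hx)

-- GATE-DEDUP: `private` — a verbatim twin of `…RigidCoreSchanuelOnLogFreeCoreCalibrationR.transcendental_pi_complex`.
/-- `π ∈ ℂ` is transcendental (tree fact `transcendental_pi_holds`, transported along `ℝ → ℂ`). -/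
private theorem transcendental_pi_complex : Transcendental ℚ (Real.pi : ℂ) := fun hc =>
  transcendental_pi_holds ((isAlgebraic_algebraMap_iff (algebraMap ℝ ℂ).injective).mp hc)

section Family

variable {m : ℕ} {b : Fin m → ℂ} {τ : ℂ}

/-- (i) `(τ | b)` is ℚ-free when `τ` is transcendental and `b` is ℚ-free algebraic. -/
theorem cons_linearIndependent (hτ : Transcendental ℚ τ) (hb : LinearIndependent ℚ b)
    (halg : ∀ j, IsAlgebraic ℚ (b j)) : LinearIndependent ℚ (Fin.cons τ b : Fin (m + 1) → ℂ) := by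
  rw [linearIndependent_finCons]
  exact ⟨hb, fun hmem => hτ (isAlgebraic_of_mem_span_of_isAlgebraic halg hmem)⟩

/-- Coordinates along `τ`: an element of `span_ℚ (τ | b)` is `q•τ + (algebraic)`. -/
theorem mem_span_cons_iff (x : ℂ) :
    x ∈ Submodule.span ℚ (Set.range (Fin.cons τ b : Fin (m + 1) → ℂ)) ↔
      ∃ q : ℚ, ∃ p ∈ Submodule.span ℚ (Set.range b), x = q • τ + p := by
  rw [Fin.range_cons, Submodule.mem_span_insert]

/-- (ii) `(τ | b)` is PLAIN — its span has only RATIONAL algebraic multipliers (indeed `β τ ∈ span ⟹ β ∈ ℚ` for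
algebraic `β`): the multiplication-type hypothesis of stmt-Schanuel-31410. -/
theorem cons_multiplier_rational (hτ : Transcendental ℚ τ) (halg : ∀ j, IsAlgebraic ℚ (b j)) (β : ℂ)
    (hβ : IsAlgebraic ℚ β) (hβτ : β * τ ∈ Submodule.span ℚ (Set.range (Fin.cons τ b : Fin (m + 1) → ℂ))) :
    β ∈ Set.range (algebraMap ℚ ℂ) := by
  obtain ⟨q, p, hp, hq⟩ := (mem_span_cons_iff _).mp hβτ
  have hpalg : IsAlgebraic ℚ p := isAlgebraic_of_mem_span_of_isAlgebraic halg hp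
  by_cases hβq : β = (q : ℂ)
  · exact ⟨q, by simp [hβq]⟩
  · exfalso
    have hne : β - (q : ℂ) ≠ 0 := sub_ne_zero.mpr hβq
    have hτeq : τ = p / (β - (q : ℂ)) := by
      rw [eq_div_iff hne, Rat.smul_def] at *
      linear_combination hq
    apply hτ
    rw [hτeq]
    have hβ' : β ∈ algebraicClosure ℚ ℂ := mem_algebraicClosure_iff.mpr hβ
    have hp' : p ∈ algebraicClosure ℚ ℂ := mem_algebraicClosure_iff.mpr hpalg
    have hq' : ((q : ℚ) : ℂ) ∈ algebraicClosure ℚ ℂ := by simp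
    exact mem_algebraicClosure_iff.mp (div_mem hp' (sub_mem hβ' hq'))

/-- (ii′) The plainness hypothesis of stmt-31410 verbatim at `(τ | b)`. -/
theorem cons_plain (hτ : Transcendental ℚ τ) (halg : ∀ j, IsAlgebraic ℚ (b j)) :
    ∀ β : ℂ, IsAlgebraic ℚ β → (∀ i, β * (Fin.cons τ b : Fin (m + 1) → ℂ) i ∈
      Submodule.span ℚ (Set.range (Fin.cons τ b : Fin (m + 1) → ℂ))) → β ∈ Set.range (algebraMap ℚ ℂ) :=
  fun β hβ h => cons_multiplier_rational hτ halg β hβ (by have h0 := h 0; rwa [Fin.cons_zero] at h0)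

/-- (iii) `(τ | b)` has LW-level `m` (witness `b` itself: `e^{b_j} ∈ F_z`). -/
theorem cons_lwLevel (hb : LinearIndependent ℚ b) (halg : ∀ j, IsAlgebraic ℚ (b j)) :
    LWLevel m (Fin.cons τ b : Fin (m + 1) → ℂ) :=
  ⟨b, hb, halg, fun j => exp_isAlgebraic_of_mem_span (Submodule.subset_span ⟨j.succ, by simp⟩)⟩

/-- **(iv) THE SUB-LEVEL LEMMA.**  Every ℚ-free `k`-tuple `w` inside `span_ℚ(τ | b)` has LW-level `≥ k − 1`:
`dim (span w ∩ span b) ≥ k + m − (m + 1)` (Grassmann), and a basis of that intersection is a ℚ-free ALGEBRAIC family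
inside `span w`, whose exponentials are algebraic over `F_w`.  Hypothesis-free linear algebra (`τ` arbitrary). -/
theorem lwLevel_of_mem_span_cons (hb : LinearIndependent ℚ b) (halg : ∀ j, IsAlgebraic ℚ (b j)) {k : ℕ}
    {w : Fin k → ℂ} (hw : LinearIndependent ℚ w)
    (hmem : ∀ j, w j ∈ Submodule.span ℚ (Set.range (Fin.cons τ b : Fin (m + 1) → ℂ))) :
    LWLevel (k - 1) w := by
  classical
  set W : Submodule ℚ ℂ := Submodule.span ℚ (Set.range w) with hW
  set A : Submodule ℚ ℂ := Submodule.span ℚ (Set.range b) with hA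
  set V : Submodule ℚ ℂ := Submodule.span ℚ (Set.range (Fin.cons τ b : Fin (m + 1) → ℂ)) with hV
  haveI : FiniteDimensional ℚ ↥W := FiniteDimensional.span_of_finite ℚ (Set.finite_range _)
  haveI : FiniteDimensional ℚ ↥A := FiniteDimensional.span_of_finite ℚ (Set.finite_range _)
  haveI : FiniteDimensional ℚ ↥V := FiniteDimensional.span_of_finite ℚ (Set.finite_range _)
  have hWk : Module.finrank ℚ ↥W = k := by simpa using finrank_span_eq_card hw
  have hAm : Module.finrank ℚ ↥A = m := by simpa using finrank_span_eq_card hb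
  have hVle : Module.finrank ℚ ↥V ≤ m + 1 := (finrank_range_le_card _).trans (Fintype.card_fin _).le
  have hWV : W ≤ V := span_range_le hmem
  have hAV : A ≤ V := span_range_le fun j => Submodule.subset_span ⟨j.succ, by simp⟩
  have hsup : Module.finrank ℚ ↥(W ⊔ A) ≤ m + 1 := (Submodule.finrank_mono (sup_le hWV hAV)).trans hVle
  have hdim := Submodule.finrank_sup_add_finrank_inf_eq W A
  have hinf : k - 1 ≤ Module.finrank ℚ ↥(W ⊓ A) := by omega
  -- a basis of `W ⊓ A`
  obtain ⟨a, ℓ, hℓ, hℓW, hℓA, hspan⟩ := exists_basis_span_inf w A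
  haveI : FiniteDimensional ℚ ↥(Submodule.span ℚ (Set.range ℓ)) :=
    FiniteDimensional.span_of_finite ℚ (Set.finite_range _)
  have hle : W ⊓ A ≤ Submodule.span ℚ (Set.range ℓ) := fun x hx => hspan x hx.1 hx.2
  have ha : k - 1 ≤ a := by
    have h1 := Submodule.finrank_mono hle
    have h2 : Module.finrank ℚ ↥(Submodule.span ℚ (Set.range ℓ)) = a := by simpa using finrank_span_eq_card hℓ
    omega
  exact ⟨ℓ ∘ Fin.castLE ha, linearIndependent_comp_castLE ha hℓ,
    fun j => isAlgebraic_of_mem_span_of_isAlgebraic halg (hℓA _),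
    fun j => exp_isAlgebraic_of_mem_span (hℓW _)⟩

/-- (v) Hence `(τ | b)` is SUB-MINIMAL (every ℚ-free `k`-tuple of its span has `k ≤ trdeg F_w + 1`, by the level
inequality at level `k − 1`) — the first-failure hypothesis of stmt-31410, CERTIFIED, at every length. -/
theorem cons_subMinimal (hb : LinearIndependent ℚ b) (halg : ∀ j, IsAlgebraic ℚ (b j)) :
    SubMinimalDefect (m + 1) (Fin.cons τ b : Fin (m + 1) → ℂ) := by
  intro k w _ hw hmem
  have h := le_trdeg_of_lwLevel w (lwLevel_of_mem_span_cons hb halg hw hmem)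
  obtain ⟨t, ht, _⟩ := trdeg_eq_nat w
  rw [ht] at h ⊢
  have h' : k - 1 ≤ t := by exact_mod_cast h
  exact_mod_cast (show k ≤ t + 1 by omega)

/-- **(vi) `(τ | b)` IS A MEMBER OF stmt-31410's HYPOTHESIS CLASS** (ℚ-free ∧ plain ∧ sub-minimal), certified. -/
theorem cons_mem_plainClass (hτ : Transcendental ℚ τ) (hb : LinearIndependent ℚ b)
    (halg : ∀ j, IsAlgebraic ℚ (b j)) :
    LinearIndependent ℚ (Fin.cons τ b : Fin (m + 1) → ℂ) ∧
      (∀ β : ℂ, IsAlgebraic ℚ β → (∀ i, β * (Fin.cons τ b : Fin (m + 1) → ℂ) i ∈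
        Submodule.span ℚ (Set.range (Fin.cons τ b : Fin (m + 1) → ℂ))) → β ∈ Set.range (algebraMap ℚ ℂ)) ∧
      SubMinimalDefect (m + 1) (Fin.cons τ b : Fin (m + 1) → ℂ) :=
  ⟨cons_linearIndependent hτ hb halg, cons_plain hτ halg, cons_subMinimal hb halg⟩

/-- **(vii) THE CONCLUSION OF stmt-31410 AT `(τ | b)`, PROVED OUTRIGHT** (`trdeg F_z ≥ m = n − 1`; hypothesis-free,
`τ` arbitrary). -/
theorem defectOne_at_cons (hb : LinearIndependent ℚ b) (halg : ∀ j, IsAlgebraic ℚ (b j)) :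
    ((m + 1 : ℕ) : Cardinal) ≤ Algebra.trdeg ℚ ↥(adjoin ℚ (Set.range (Fin.cons τ b : Fin (m + 1) → ℂ) ∪
      Set.range (cexp ∘ (Fin.cons τ b : Fin (m + 1) → ℂ)))) + 1 := by
  have h := le_trdeg_of_lwLevel _ (cons_lwLevel (τ := τ) hb halg)
  push_cast
  exact add_le_add h le_rfl


/-- (viii) The family sits on the SATURATED side of the level cut and is NOT in the new residual's class. -/
theorem cons_not_deficient (hb : LinearIndependent ℚ b) (halg : ∀ j, IsAlgebraic ℚ (b j)) :
    ¬ ¬ LWLevel (m + 1 - 1) (Fin.cons τ b : Fin (m + 1) → ℂ) :=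
  fun h => h (by rw [Nat.add_sub_cancel]; exact cons_lwLevel (τ := τ) hb halg)

end Family

/-! ### §4c Members at EVERY length (roots of unity give ℚ-free algebraic tuples of any size) -/

/-- ℚ-free algebraic tuples of every length exist (powers of a primitive `p`-th root of unity, `p > m` prime). -/
theorem exists_algebraic_free (m : ℕ) : ∃ b : Fin m → ℂ, LinearIndependent ℚ b ∧ ∀ j, IsAlgebraic ℚ (b j) := by
  obtain ⟨p, hmp, hp⟩ := Nat.exists_infinite_primes (m + 1)
  have hp0 : p ≠ 0 := hp.ne_zero
  set μ : ℂ := cexp (2 * (Real.pi : ℂ) * I / (p : ℂ)) with hμ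
  have hprim : IsPrimitiveRoot μ p := Complex.isPrimitiveRoot_exp p hp0
  have hdeg : (minpoly ℚ μ).natDegree = p - 1 := by
    rw [← Polynomial.cyclotomic_eq_minpoly_rat hprim hp.pos, Polynomial.natDegree_cyclotomic, Nat.totient_prime hp]
  have hli : LinearIndependent ℚ fun i : Fin (minpoly ℚ μ).natDegree => μ ^ (i : ℕ) := linearIndependent_pow μ
  have hm : m ≤ (minpoly ℚ μ).natDegree := by rw [hdeg]; omega
  have hμalg : IsAlgebraic ℚ μ :=
    IsAlgebraic.of_pow hp.pos (by rw [hprim.pow_eq_one]; exact isAlgebraic_one)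
  refine ⟨(fun i : Fin (minpoly ℚ μ).natDegree => μ ^ (i : ℕ)) ∘ Fin.castLE hm,
    linearIndependent_comp_castLE hm hli, fun j => ?_⟩
  exact mem_algebraicClosure_iff.mp (pow_mem (mem_algebraicClosure_iff.mpr hμalg) _)

/-- **AT EVERY LENGTH `n ≥ 1` stmt-31410's class has a certified member on which its conclusion is PROVED and which
lies on the saturated (decided) side of the level cut** — the special side is inhabited and decided at all lengths. -/
theorem exists_decided_plain_member (n : ℕ) (hn : 1 ≤ n) :
    ∃ z : Fin n → ℂ, (LinearIndependent ℚ z ∧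
      (∀ β : ℂ, IsAlgebraic ℚ β → (∀ i, β * z i ∈ Submodule.span ℚ (Set.range z)) →
        β ∈ Set.range (algebraMap ℚ ℂ)) ∧ SubMinimalDefect n z) ∧ LWLevel (n - 1) z ∧
      (n : Cardinal) ≤ Algebra.trdeg ℚ ↥(adjoin ℚ (Set.range z ∪ Set.range (cexp ∘ z))) + 1 := by
  obtain ⟨m, rfl⟩ : ∃ m, n = m + 1 := ⟨n - 1, by omega⟩
  obtain ⟨b, hb, halg⟩ := exists_algebraic_free m
  refine ⟨Fin.cons (Real.pi : ℂ) b, cons_mem_plainClass transcendental_pi_complex hb halg, ?_, ?_⟩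
  · rw [Nat.add_sub_cancel]; exact cons_lwLevel hb halg
  · exact_mod_cast defectOne_at_cons (τ := (Real.pi : ℂ)) hb halg

end Summit.Schanuel.Schanuel.Theorems.RootDecomp1ELevels

end
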